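import Mathlib
import HarnessLib

/-!
# STUB 2 of the `WindowCertificateMargin` skeleton (stmt-NavierStokesRegularity-23648):
polynomial evaluation along the window-coordinate map is `C¹`

Route `route-NavierStokesRegularity-BarrierStepRungThree`, LINE g2-2 (polynomial window certificate).
The registered birth skeleton `Cruxes/WindowCertificateMargin` composes
`PolynomialWindowCertificate` (STUB 1, item stmt-NavierStokesRegularity-23942) with this analysis
stub to obtain `WindowCertificateMargin`: the clock/barrier `v` and the goal `g` of the polynomial
certificate are evaluations of real multivariate polynomials in the finitely many window coordinates
`x i j` (`i : Fin 4`, `j : Fin n`), hence `C¹` (indeed analytic), which supplies the two regularity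
clauses `ContDiff ℝ 1 v` and `Continuous g` of `WindowCertificateMargin`.

Proof: each coordinate `x ↦ x ij.1 ij.2` is a continuous linear functional on `Fin 4 → Fin n → ℝ`
(composition of two evaluation maps), so `AnalyticOnNhd.eval_continuousLinearMap'` makes the
evaluation analytic on `univ`, and analytic maps are `C^m` for every `m`.
-/

-- the sub-problem namespace `Summit.NavierStokesRegularity.NavierStokesRegularity` repeats the summit name by design (D-0017)
set_option linter.dupNamespace false

namespace Summit.NavierStokesRegularity.NavierStokesRegularity.Theorems.WindowCertificateMargin

/-- The window coordinate `x ↦ x ij.1 ij.2` as a continuous linear functional on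
`Fin 4 → Fin n → ℝ`. -/
theorem coordCLM_apply (n : ℕ) (ij : Fin 4 × Fin n) (x : Fin 4 → Fin n → ℝ) :
    ((ContinuousLinearMap.proj (R := ℝ) ij.2).comp
      (ContinuousLinearMap.proj (R := ℝ) (φ := fun _ : Fin 4 => Fin n → ℝ) ij.1)) x = x ij.1 ij.2 :=
  rfl

/-- Evaluation of a real multivariate polynomial in the window coordinates is real-analytic on the
whole space `Fin 4 → Fin n → ℝ`. -/
theorem polyEval_analyticOnNhd (n : ℕ) (p : MvPolynomial (Fin 4 × Fin n) ℝ) :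
    AnalyticOnNhd ℝ
      (fun x : Fin 4 → Fin n → ℝ => MvPolynomial.eval (fun ij : Fin 4 × Fin n => x ij.1 ij.2) p)
      Set.univ := by
  have h := AnalyticOnNhd.eval_continuousLinearMap' (𝕜 := ℝ) (E := Fin 4 → Fin n → ℝ)
    (fun ij : Fin 4 × Fin n => (ContinuousLinearMap.proj (R := ℝ) ij.2).comp
      (ContinuousLinearMap.proj (R := ℝ) (φ := fun _ : Fin 4 => Fin n → ℝ) ij.1)) p
  simpa only [coordCLM_apply] using h

/-- Evaluation of a real multivariate polynomial in the window coordinates is `C^m` for every `m`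
(in particular smooth). -/
theorem polyEval_contDiff (n : ℕ) (p : MvPolynomial (Fin 4 × Fin n) ℝ) {m : WithTop ℕ∞} :
    ContDiff ℝ m
      (fun x : Fin 4 → Fin n → ℝ => MvPolynomial.eval (fun ij : Fin 4 × Fin n => x ij.1 ij.2) p) :=
  (polyEval_analyticOnNhd n p).contDiff

/-- STUB 2 of the registered `WindowCertificateMargin` skeleton, exactly as registered: for every
window width `n` and every real polynomial `p` in the `4·n` window coordinates, the evaluation map
`x ↦ p(x)` is `C¹` on `Fin 4 → Fin n → ℝ`. -/
theorem stub_polyEval_contDiff : ∀ (n : ℕ) (p : MvPolynomial (Fin 4 × Fin n) ℝ),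
    ContDiff ℝ 1 (fun x : Fin 4 → Fin n → ℝ =>
      MvPolynomial.eval (fun ij : Fin 4 × Fin n => x ij.1 ij.2) p) :=
  fun n p => polyEval_contDiff n p

/-- Continuity form of STUB 2 (used for the goal function `g` of the polynomial certificate). -/
theorem polyEval_continuous (n : ℕ) (p : MvPolynomial (Fin 4 × Fin n) ℝ) :
    Continuous (fun x : Fin 4 → Fin n → ℝ =>
      MvPolynomial.eval (fun ij : Fin 4 × Fin n => x ij.1 ij.2) p) :=
  (polyEval_contDiff n p (m := 0)).continuous

end Summit.NavierStokesRegularity.NavierStokesRegularity.Theorems.WindowCertificateMargin
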